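import Literature.MathematicalPhysics.QuantumFieldTheory.Balaban1983to89.B15Prop1Thm1RowsOfExistsUnique
import Literature.MathematicalPhysics.QuantumFieldTheory.Balaban1983to89.B15Prop1ChartDeviation
import Literature.MathematicalPhysics.QuantumFieldTheory.Balaban1983to89.B15Prop1SliceTaylorCalculus

/-!
# `Balaban1983to89.B15Prop1MinimiserClassAtDatumScale` — [Balaban1985Variational] = «[15]», Thm 1 (6)–(8) pp. 278–279; [Balaban1989LargeFieldI] = «[IV]», (1.74) p. 192,
# p. 193, Prop. 1 p. 194 («for ε > 0 sufficiently small»); [Balaban1989LargeFieldII] = «[LF-II]», p. 357, (1.7) p. 358; [Balaban1988Convergent] = «[III]», (2.12)–(2.13) pp. 256–257: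
# THE MINIMISER OF AN `a`-REGULAR DATUM LIES IN — AND MINIMISES OVER — THE (2.12) CLASS AT THE DATUM's OWN SCALE `B₃·a`; THE (J0′) FAMILY's REAL POINTS NEAR THE BASE LIKEWISE

Honest framing: statement-level skeleton of published theorems with citation tags; proofs where landed; nothing here is a claim about the Yang–Mills mass gap.  Cell `pub-ymgap`
(HUMAN RULINGS D-0062 ∕ D-0149), lane `pub-ymgap-dag-n12-c` g31 (R134 seat (a), N12 = [B15], s1, LANE OWNER); count-neutral helper of K1⁹ `stmt-QuantumFields-27364`
(`--kind proof --supports`); N12 NOT discharged; one finite 𝕋⁴ programme at fixed ε; nothing continuum ∕ ℝ⁴ ∕ OS ∕ mass-gap ∕ Clay.  THEOREMS ONLY (0 `def`, 0 `instance`, 0 `sorry`).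

WHY (dag-n12-d g27 ⚑ LOCATED «(J0′) × DIRECT: RADIUS COUPLING», kernel certificate `Summits/…/BalabanUVNodesN12DirectWindowRadiusFloor` ✓p744117; lane ruling «ROAD (B) (8)-FLOOR»,
pub-ymgap INBOX 2026-08-29T21:24Z).  N12's direct-road socket of record (v12 T4 `…WindowDirectOfClassOnlyRowL1NearRadiusOfRecord`) reads the base minimiser's fine-scale flatness —
hence its three tolerance FLOORS `C₁(d,L)·εreg + m′ρn ≤ δ`, `6(d−1)L·εreg ≤ ρ5`, `6(d−1)L·εreg ≤ ρ6` — off MEMBERSHIP IN THE CLASS OF RECORD `U_k({Ω_j(Z)}, εreg)`, while its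
threshold reads the (J0′) analyticity radius through the Cauchy quotient `12𝓐₀∕R`; since every real point of the (J0′) family must be a class-minimiser, `R = O(εreg)`, and the window
`[C₁εreg, Thr(R)]`, `Thr ∝ R²`, is EMPTY as typed.  Print never couples these: [15] Theorem 1 (8) places the minimiser of an `a`-regular datum in the class at tolerance `B₃·a` — the
DATUM's scale (`ε_k ≪ ε₀` in [IV]) — and Prop. 1 is stated «for ε > 0 sufficiently small» PER INSTANCE ([IV] p. 194; `B15Prop1Carrier.prop1Printed_lfVarOn_iff`: `∃ e0 > 0, ∀ ε ≤ e0`).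
THIS FILE supplies the junction lemmas that let the socket read all three floors at the datum scale `eR` instead of `εreg` (floor ∝ eR, threshold ∝ R² with `R` independent of `eR`
⇒ a checkable per-instance smallness condition on the data budget): for the (1.74) datum of an `eR`-regular base field and for the (J0′) family's REAL points within `eR∕8` of it,
every minimiser over the class of record lies in, and minimises over, the class at every tolerance `e ∈ [2B₃(c_E+1)eR, εreg]` — from K0⁷'s (8)-letter `h15T` ALONE (the text displayed
by `B15Prop1Thm1RowsOfExistsUnique.thm1Rows_atZ_of_thm1TorusClass_existsUnique`, served by `Node00.VariationalThm1RegSepCoP7M` through dag-n12-d's `thm1TorusClass_of_variationalThm1RegSepCoP7M`).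

CONTENTS.  §1 ★★ `mem_withEps_and_isMinimizer_withEps_of_plaqSmallOn` — the core: an `a`-regular level-`k` field `V` on the `k`-plaquettes inside `Z` (`a ≤ a₁`, `B₃a ≤ e ≤ εreg ≤ a₀`);
every minimiser `U₀` over `U_k({Ω_j(Z)}, εreg)` with the data `M˙(Q_k^{s*}V)` on `𝐁_k(Z)` lies in `U_k({Ω_j(Z)}, B₃a)` and minimises over `U_k({Ω_j(Z)}, e)` (proof: `Z`'s maximal
sequence as a separated (2.18) index re-indexed over NODE 00's torus class, print's (7) for the datum at the constant profile `a` (g11 `dataSmall7PTop_avgFamily_qsstarGIter0`), (8) by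
`h15T` at `ε₀ := εreg`, the class literal = the class of record at `ν⟨εreg := ·⟩`, monotonicity of the class in its tolerance and of `IsMinimizer` under membership — all ✓p729581 §1–§2).
§2 ★ `plaqSmallOn_expMul_extend_expMul` — the PERTURBED (J0′) datum `e^{iB′}·ext(e^{ip}·V_k)` is `(c_E+1)(eR + 4‖p‖ + 4‖B′‖)`-regular on the `k`-plaquettes inside `Z`
(`B15Prop1ChartDeviation.dist1_plaqHol_expMul_le_of_forall`, `B15Prop1ChartSU2.dist1_iexp_apply_le`, g3 `dist1_plaqHol_extend_shellGauge_le`); ★ `plaqSmallOn_extend_of_guard` — the base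
case `p = B′ = 0` at `(c_E+1)·eR`.  §3 ★★★ `isMinimizer_withEps_base_of_thm1TorusClass` (the BASE point: minimality at every `e ∈ [B₃(c_E+1)eR, εreg]` + membership at `B₃(c_E+1)eR`)
and ★★★ `hMin_twoRadii_withEps_of_hMin` — T4's `hMin` body at one base field VERBATIM (class of record, ONE radius `R`, bound `𝓐`) ⟹ the TWO-RADII body: clauses 1–2 (analytic, bounded)
on the ball `R` verbatim ∧ clause 3 (real points are minimisers) over the class at ANY `e ∈ [2B₃(c_E+1)eR, εreg]` on the ball `min R (eR∕8)`.  §4 ★★★ `eventually_isMinimizer_withEps_of_eventually` — the chart half's `∀ᶠ` premise (T4 :233–:235: the Federbush family's configurations are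
class-of-record minimisers of the data `e^{i·ιA Y}·ext V_k` for `Y` near `0`) ⟹ for `Y` near `0` they lie in the class at `2B₃(c_E+1)eR` and minimise over the class at `e` (dag-n12-d's
callback (K-b); radius form ★★★ `isMinimizer_withEps_of_norm_lt` on `‖Y‖ < eR∕8`; `B15Prop1SliceTaylorCalculus.norm_ιA_le` by name).  §0 `regMSCoPOfRecord_withEps_subset` (bookkeeping).

HONEST SCOPE.  Bookkeeping by name over landed modules; [15] Theorem 1 (8) stays DISPLAYED as the closed letter `h15T` (nothing of Bałaban's asserted); per-instance constants (census U4);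
count-neutral; N12 NOT discharged; K0⁷ ∕ K1⁹ NOT closed; counts unmoved; R4 closes only the conditional finite-𝕋⁴ rung `BalabanLadder.UV` — no summit statement is proved here and NOT
the Yang–Mills mass gap (Clay); nothing continuum ∕ ℝ⁴ ∕ OS.
-/

noncomputable section

open Set

namespace Literature.MathematicalPhysics.QuantumFieldTheory.Balaban1983to89.B15Prop1MinimiserClassAtDatumScale

open T4Continuum B15DeterminingSets GaugeField B15Prop1Carrier B8Eq17ClassAkV1 BlockAveraging
open B14.Eq22Determines (IsBlockUnion)
open Literature.MathematicalPhysics.QuantumFieldTheory.BalabanImbrieJaffe1984to88.BIJ85Eq453GaugeField (qsstarGIter0)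
open B15Prop1DatumSmall7AtZSequence B15Prop1Thm1GeneralFormAtZSequence B15Prop1Thm1GeneralFormShapes B15Prop1Thm1RowsOfExistsUnique
open B16Sect1Backgrounds (toMS expMul)
open B14DomainGeom (IsUnionOfCubes)
open B15Eq112TorusCover (cover)
open B14.Eq213MaximalDomains (side)
open B14.Eq213DetSet B15Sect1Instances B16Sect1Wilson
open T4CubeChartGnomonic (SU2)
open T4AxialGaugeSmallField (castSite boxPlaqs)
open B15Extension193 (extend)
open B15ShellGauge193 (shellGauge)
open B15ShellGauge193Local (dist1_plaqHol_extend_shellGauge_le)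
open B15Prop1ChartDeviation (dist1_plaqHol_expMul_le_of_forall)
open B15Prop1ChartSU2 (su2Chart dist1_iexp_apply_le)
open B15Prop1ChartCalculusSU2 (E3)
open B15Prop1AnalyticExtClause (cplxVec)
open Metric (ball)

variable {F : T4Family}

/-! ## §0  Bookkeeping: resetting the class tolerance to its own value -/

/-- The class of record at `ν⟨εreg := e⟩` for `e ≤ ν.εreg` lies in the class of record at `ν` (`ν⟨εreg := ν.εreg⟩ = ν` by structure eta). [cite: Balaban1985Variational, (2), (6) p.278; Balaban1988Convergent, (2.12) p.256] -/
theorem regMSCoPOfRecord_withEps_subset (ν : Node00.Stage7Numerics) (Kt k : ℕ) (Ω : ℕ → Set (Site (F.P Kt) 0)) {e : ℝ} (he : e ≤ ν.εreg) :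
    Node00.regMSCoPOfRecord F 2 {ν with εreg := e} Kt k Ω ⊆ Node00.regMSCoPOfRecord F 2 ν Kt k Ω :=
  regMSCoPOfRecord_mono_eps (F := F) (N := 2) ν Kt k Ω he

/-- `0 < η_j`. [folklore] -/
private theorem eta_pos (K j : ℕ) : 0 < (F.P K).eta j := by
  have hL : (0 : ℝ) < (F.P K).L := by exact_mod_cast (F.P K).L_pos
  unfold Params.eta
  positivity

/-! ## §1  The core: a minimiser over the class of record of an `a`-regular datum lies in the class at `B₃a` and minimises over the class at every `e ∈ [B₃a, εreg]` -/

section Core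

open Classical

/-- ★★ **THE MINIMISER OF AN `a`-REGULAR (1.74) DATUM LIES IN THE (2.12) CLASS AT THE DATUM's OWN SCALE `B₃a`, AND MINIMISES OVER THE CLASS AT EVERY TOLERANCE `e ∈ [B₃a, εreg]`.**
For a level-`k` field `V` with `|V(∂p′) − 1| < a` on the `k`-plaquettes inside `Z` (`0 < a ≤ a₁`, `B₃a ≤ e ≤ εreg ≤ a₀`) and ANY minimiser `U₀` of the Wilson action over NODE 00's class
of record `U_k({Ω_j(Z)}, εreg)` with the data `M˙(Q_k^{s*}V)` on `𝐁_k(Z)`: (i) `U₀ ∈ U_k({Ω_j(Z)}, B₃a)` ([15] Thm 1 (8), the closed torus-class letter `h15T` applied at `ε₀ := εreg` to the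
datum's (7) at the constant profile `a` along `Z`'s maximal sequence); (ii) `U₀` minimises over `U_k({Ω_j(Z)}, e)` (it lies in it, and that class lies in the one it minimises over).
[cite: Balaban1985Variational, (1) p.277, (2),(6),(7) p.278, Thm 1 (8) p.279; Balaban1988Convergent, (2.1) p.254, p.255, (2.12)–(2.13) pp.256–257, (2.18) p.257; Balaban1989LargeFieldI, (1.74) p.192, p.193; Balaban1985RegularSpaces, (1.3)–(1.9) p.77] -/
theorem mem_withEps_and_isMinimizer_withEps_of_plaqSmallOn (ν : Node00.Stage7Numerics) (Kt : ℕ) (hd : 2 ≤ (F.P Kt).d)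
    (Z : Set (Site (F.P Kt) 0)) {k : ℕ} (hk0 : 0 < k) (hk : k ≤ (F.P Kt).m + (F.P Kt).K) (hZblk : IsBlockUnion k Z)
    (hM2 : 2 ≤ ν.M₁) (hdiv : side (F.P Kt).L ν.M₁ k ∣ (F.P Kt).sitesPerDir 0) {B₃ a₀ a₁ : ℝ}
    -- [15] THEOREM 1 (R) = (8), CLOSED, OVER NODE 00's TORUS CLASS (K0⁷'s `VariationalThm1RegSepCoP7M` via dag-n12-d's `thm1TorusClass_of_variationalThm1RegSepCoP7M`; the text of
    -- `B15Prop1Thm1RowsOfExistsUnique.thm1Rows_atZ_of_thm1TorusClass_existsUnique`'s `h15T` VERBATIM)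
    (h15T : ∀ (k' : ℕ), k' ≤ (F.P Kt).m + (F.P Kt).K → side (F.P Kt).L ν.M₁ k' ∣ (F.P Kt).sitesPerDir 0 →
      ∀ (s : B14.Eq218Concrete.Seq (fun n : ℕ => Node00.unionsOfCubes (F.P Kt) (side (F.P Kt).L ν.M₁ n)) k'),
      Node00.Sect2.SeqSeparated ν.M₁ s → 0 < ν.M₁ →
      ∀ (ε₀ : ℝ) (δ : ℕ → ℝ), (∀ j, j ≤ k' → 0 < δ j ∧ δ j ≤ a₁ ∧ B₃ * δ j ≤ ε₀) → (∀ j, j < k' → δ j ≤ 2 * δ (j + 1)) →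
      (∀ j, j < k' → δ (j + 1) ≤ 2 * δ j) → ε₀ ≤ a₀ →
      ∀ W : MSField (F.P Kt) SU2,
        Node00.Sect2.DataSmall7PTop (Node00.avOfRecord F 2 Kt) s.Ω (Node00.suppDomOfRecord F ν Kt s.Ω) k' δ W →
        ∀ U₀ : GaugeField (F.P Kt) 0 SU2, IsMinimizer (Node00.avOfRecord F 2 Kt)
            {U | (∀ j, j ≤ k' → PlaqSmallOn (Node00.Sect2.omegaPlaqsTop s.Ω (Node00.suppDomOfRecord F ν Kt s.Ω) j)
                (ε₀ * (F.P Kt).eta j ^ 2) U) ∧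
              Node00.Sect2.CoDivClassOnTop s.Ω (Node00.suppDomOfRecord F ν Kt s.Ω) k' ε₀ U}
            (genSet s.Ω k') W U₀ →
          (∀ j, j ≤ k' → PlaqSmallOn (Node00.Sect2.omegaPlaqsTop s.Ω (Node00.suppDomOfRecord F ν Kt s.Ω) j)
              (B₃ * δ j * (F.P Kt).eta j ^ 2) U₀) ∧
            ∀ j, j ≤ k' → Node00.Sect2.CoDivSmallOn (Node00.Sect2.omegaBondsTop s.Ω (Node00.suppDomOfRecord F ν Kt s.Ω) j)
              (B₃ * δ j * (F.P Kt).eta j ^ 3) U₀) :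
    ∀ (a e : ℝ) (V : GaugeField (F.P Kt) k SU2), 0 < a → a ≤ a₁ → B₃ * a ≤ e → e ≤ ν.εreg → ν.εreg ≤ a₀ →
      PlaqSmallOn (plaqsInside (pts k Z)) a V →
      ∀ U₀ : GaugeField (F.P Kt) 0 SU2,
        IsMinimizer (Node00.avOfRecord F 2 Kt) (Node00.regMSCoPOfRecord F 2 ν Kt k (maxDomT ν.M₁ Z)) (Bj ν.M₁ Z k)
          (avgFamily (Node00.avOfRecord F 2 Kt) (qsstarGIter0 k V)) U₀ →
        U₀ ∈ Node00.regMSCoPOfRecord F 2 {ν with εreg := B₃ * a} Kt k (maxDomT ν.M₁ Z) ∧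
          IsMinimizer (Node00.avOfRecord F 2 Kt) (Node00.regMSCoPOfRecord F 2 {ν with εreg := e} Kt k (maxDomT ν.M₁ Z)) (Bj ν.M₁ Z k)
            (avgFamily (Node00.avOfRecord F 2 Kt) (qsstarGIter0 k V)) U₀ := by
  intro a e V ha haa₁ hae heν ha₀ hV U₀ hU₀
  have hM : 1 ≤ ν.M₁ := le_trans one_le_two hM2
  have hki : 1 ≤ k := hk0
  -- `Z`'s maximal sequence as a separated (2.18) index, with print's cube letters, re-indexed over NODE 00's torus class
  obtain ⟨s, hsΩ, -, hscube, hsep⟩ := exists_seq_maxDomT hM Z hdiv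
  obtain ⟨s', hΩ'⟩ := exists_seq_torusClass_of_cubeLetters hM s hscube
  have hsep' : Node00.Sect2.SeqSeparated ν.M₁ s' := (seqSeparated_iff_of_Ω_eq ν.M₁ hΩ').2 hsep
  have hw1 : s.Ω 1 = maxDomT ν.M₁ Z 1 := hsΩ 1 le_rfl hki
  -- print's (7) for the datum ALONG THE INDEX `s.Ω`, constant profile `a`
  have h0 : Node00.Sect2.printedPlaqsTop s.Ω (Node00.suppDomOfRecord F ν Kt s.Ω) k ⊆ plaqsInside Z := by
    rw [printedPlaqsTop_congr hki hsΩ, Node00.suppDomOfRecord_congr (F := F) ν Kt hw1]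
    exact printedPlaqsTop_maxDomT_subset_plaqsInside hM hdiv hki k
  have hsucc : ∀ m, m + 1 ≤ k → Node00.Sect2.printedPlaqs s.Ω k (m + 1) ⊆ plaqsInside (pts (m + 1) Z) := by
    intro m hm
    refine (Node00.Sect2.printedPlaqs_subset_plaqsOf _ _ _).trans ?_
    refine (plaqsOf_mono (genSet_subset_pts_of_one_le s.Ω k (Nat.succ_pos m))).trans ?_
    rw [hsΩ (m + 1) (Nat.succ_pos m) hm]
    exact plaqsOf_pts_maxDomT_subset_plaqsInside hM2 hdiv (Nat.succ_pos m) hm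
  have h7 : Node00.Sect2.DataSmall7PTop (Node00.avOfRecord F 2 Kt) s.Ω (Node00.suppDomOfRecord F ν Kt s.Ω) k
      (fun _ => a) (avgFamily (Node00.avOfRecord F 2 Kt) (qsstarGIter0 k V)) :=
    dataSmall7PTop_avgFamily_qsstarGIter0 hd ExpMeanLog.expMeanLogSU T3DescentFibreTower.expMeanLogSU_E_one rfl hk
      s.Ω _ Z hZblk h0 hsucc (fun _ _ => ha) V (fun _ _ => hV)
  -- numerics of the thresholds at `ε₀ := εreg`
  have hnum : ∀ j, j ≤ k → 0 < a ∧ a ≤ a₁ ∧ B₃ * a ≤ ν.εreg := fun j _ => ⟨ha, haa₁, hae.trans heν⟩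
  -- (8) at the index `s'`, read back at `s.Ω`, applied to the datum at `ε₀ := εreg`
  have h8 := h15T k hk hdiv s' hsep' hM
  rw [hΩ'] at h8
  have h8W := h8 ν.εreg (fun _ => a) hnum (fun _ _ => by linarith) (fun _ _ => by linarith) ha₀ _ h7
  clear h8
  -- the class literal at `εreg` IS the class of record (at `ν⟨εreg := εreg⟩ = ν`); the (1.74) class and determining set at `maxDomT ν.M₁ Z` ARE those at the index `s`
  rw [setOf_class_eq_regMSCoPOfRecord] at h8W
  have hreg0 : Node00.regMSCoPOfRecord F 2 ν Kt k (maxDomT ν.M₁ Z) = Node00.regMSCoPOfRecord F 2 ν Kt k s.Ω := (regMSCoPOfRecord_congr F 2 _ Kt hki hsΩ).symm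
  have hreg : ∀ e' : ℝ, Node00.regMSCoPOfRecord F 2 {ν with εreg := e'} Kt k (maxDomT ν.M₁ Z) =
      Node00.regMSCoPOfRecord F 2 {ν with εreg := e'} Kt k s.Ω := fun e' => (regMSCoPOfRecord_congr F 2 _ Kt hki hsΩ).symm
  have hB : Bj ν.M₁ Z k = genSet s.Ω k := (genSet_congr hki hsΩ).symm
  rw [hreg0, hB] at hU₀
  have h8U := h8W U₀ hU₀
  -- (i) membership at every tolerance `e' ≥ B₃a` (at the index `s.Ω`)
  have hmem : ∀ e' : ℝ, B₃ * a ≤ e' → U₀ ∈ Node00.regMSCoPOfRecord F 2 {ν with εreg := e'} Kt k s.Ω := by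
    intro e' he'
    refine ⟨fun j hj p hp => ((h8U.1 j hj) p hp).trans_le ?_, fun j hj b hb => ((h8U.2 j hj) b hb).trans_le ?_⟩
    · exact mul_le_mul_of_nonneg_right he' (pow_nonneg (eta_pos Kt j).le 2)
    · exact mul_le_mul_of_nonneg_right he' (pow_nonneg (eta_pos Kt j).le 3)
  refine ⟨?_, ?_⟩
  · rw [hreg (B₃ * a)]
    exact hmem (B₃ * a) le_rfl
  · -- (ii) minimality over the class at `e`: `U₀ ∈` class(e) `⊆` class(εreg) over which it minimises
    rw [hreg e, hB]
    exact isMinimizer_of_mem_of_subset (Node00.avOfRecord F 2 Kt) hU₀ (regMSCoPOfRecord_withEps_subset ν Kt k s.Ω heν) (hmem e hae)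

end Core

/-! ## §2  Regularity of the base and of the perturbed (J0′) datum on the `k`-plaquettes inside `Z` -/

section Perturbed

variable {Kt : ℕ}

/-- **`|(e^{iX}·V)(∂p) − 1| ≤ |V(∂p) − 1| + 4‖X‖`** for the `SU(2)` chart (`‖e^{iX(b)} − 1‖ ≤ ‖X(b)‖ ≤ ‖X‖`). [cite: Balaban1989LargeFieldI, Prop. 1 (1.78) p.194; Balaban1989LargeFieldII, p.359] -/
theorem dist1_plaqHol_expMul_su2Chart_le {k : ℕ} (X : VecField (F.P Kt) k E3) (V : GaugeField (F.P Kt) k SU2) (q : Plaq (F.P Kt) k) :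
    dist1 (plaqHol (expMul su2Chart X V) q) ≤ dist1 (plaqHol V q) + 4 * ‖X‖ :=
  dist1_plaqHol_expMul_le_of_forall su2Chart X V q fun b => dist1_iexp_apply_le X (fun b' => norm_le_pi_norm X b') b

/-- An `ε`-regular field perturbed by `e^{ip}` is `(ε + 4‖p‖)`-regular on the same plaquette set. [cite: Balaban1989LargeFieldI, Prop. 1 (1.78) p.194] -/
theorem plaqSmallOn_expMul_of_plaqSmallOn {k : ℕ} {S : Set (Plaq (F.P Kt) k)} {ε : ℝ} {V : GaugeField (F.P Kt) k SU2} (hV : PlaqSmallOn S ε V)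
    (p : VecField (F.P Kt) k E3) : PlaqSmallOn S (ε + 4 * ‖p‖) (expMul su2Chart p V) :=
  fun q hq => (dist1_plaqHol_expMul_su2Chart_le p V q).trans_lt (by linarith [hV q hq])

/-- ★ **THE BASE DATUM's LEVEL-`k` FIELD `ext V_k` IS `(c_E+1)·eR`-REGULAR ON THE `k`-PLAQUETTES INSIDE `Z`** for a base field `V_k` of the strict guard (`|V_k(∂p′) − 1| < eR` on the
`k`-plaquettes inside `(Z ∩ Λᶜ)^{(k)}`), the p. 193 extension of record and the knit's extension constant `c_E ≥ 12d(n+2)²`. [cite: Balaban1989LargeFieldI, p.193 L14–20 («|∂V_k − 1| < O(1)M²ε»), (1.74) p.192] -/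
theorem plaqSmallOn_extend_of_guard (hd3 : 3 ≤ (F.P Kt).d) (Z Λ : Set (Site (F.P Kt) 0)) {k : ℕ}
    (lo hi : Fin (F.P Kt).d → ℤ) (n : ℕ) (hn : ∀ κ, hi κ ≤ lo κ + n) (hlohi : lo ≤ hi)
    (hbox : pts k Λ = (castSite '' Set.Icc lo hi : Set (Site (F.P Kt) k)))
    (hZ : (boxPlaqs (lo - 1) (hi + 1) : Set (Plaq (F.P Kt) k)) ⊆ plaqsInside (pts k Z))
    (hN3 : ∀ κ, hi κ - lo κ + 3 < ((F.P Kt).sitesPerDir k : ℤ))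
    (ext : GaugeField (F.P Kt) k SU2 → GaugeField (F.P Kt) k SU2) (hext : ∀ W, ext W = extend (pts k Λ) (shellGauge W lo hi) W)
    {cE : ℝ} (hcE : 12 * ((F.P Kt).d : ℝ) * ((n : ℝ) + 2) ^ 2 ≤ cE)
    {eR : ℝ} (heR : 0 < eR) (Vk : GaugeField (F.P Kt) k SU2) (hVk : PlaqSmallOn (plaqsInside (pts k (Z ∩ Λᶜ))) eR Vk) :
    PlaqSmallOn (plaqsInside (pts k Z)) ((cE + 1) * eR) (ext Vk) := by
  intro q hq
  rw [hext]
  have h := (dist1_plaqHol_extend_shellGauge_le hd3 hlohi hn hN3 hbox hZ heR hVk).1 q hq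
  calc dist1 (plaqHol (extend (pts k Λ) (shellGauge Vk lo hi) Vk) q)
      ≤ 12 * (F.P Kt).d * (n + 2) ^ 2 * eR := h
    _ ≤ cE * eR := mul_le_mul_of_nonneg_right hcE heR.le
    _ < (cE + 1) * eR := by nlinarith

/-- ★ **THE PERTURBED (J0′) DATUM's LEVEL-`k` FIELD `e^{iB′}·ext(e^{ip}·V_k)` IS `(c_E+1)(eR + 4‖p‖ + 4‖B′‖)`-REGULAR ON THE `k`-PLAQUETTES INSIDE `Z`** — the real point `(p, B′)` of
the (J0′) family's parameter ball: `e^{ip}·V_k` is `(eR + 4‖p‖)`-regular inside `(Z ∩ Λᶜ)^{(k)}`, its p. 193 extension is `12d(n+2)²·(eR + 4‖p‖)`-regular inside `Z^{(k)}`, and `e^{iB′}`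
costs `4‖B′‖` more. [cite: Balaban1989LargeFieldI, p.193 L14–20, (1.74) p.192, Prop. 1 (1.78) p.194; Balaban1989LargeFieldII, p.357, (1.7) p.358] -/
theorem plaqSmallOn_expMul_extend_expMul (hd3 : 3 ≤ (F.P Kt).d) (Z Λ : Set (Site (F.P Kt) 0)) {k : ℕ}
    (lo hi : Fin (F.P Kt).d → ℤ) (n : ℕ) (hn : ∀ κ, hi κ ≤ lo κ + n) (hlohi : lo ≤ hi)
    (hbox : pts k Λ = (castSite '' Set.Icc lo hi : Set (Site (F.P Kt) k)))
    (hZ : (boxPlaqs (lo - 1) (hi + 1) : Set (Plaq (F.P Kt) k)) ⊆ plaqsInside (pts k Z))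
    (hN3 : ∀ κ, hi κ - lo κ + 3 < ((F.P Kt).sitesPerDir k : ℤ))
    (ext : GaugeField (F.P Kt) k SU2 → GaugeField (F.P Kt) k SU2) (hext : ∀ W, ext W = extend (pts k Λ) (shellGauge W lo hi) W)
    {cE : ℝ} (hcE : 12 * ((F.P Kt).d : ℝ) * ((n : ℝ) + 2) ^ 2 ≤ cE)
    {eR : ℝ} (heR : 0 < eR) (Vk : GaugeField (F.P Kt) k SU2) (hVk : PlaqSmallOn (plaqsInside (pts k (Z ∩ Λᶜ))) eR Vk)
    (p B' : VecField (F.P Kt) k E3) :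
    PlaqSmallOn (plaqsInside (pts k Z)) ((cE + 1) * (eR + 4 * ‖p‖ + 4 * ‖B'‖)) (expMul su2Chart B' (ext (expMul su2Chart p Vk))) := by
  have hcE0 : 0 ≤ cE := le_trans (by positivity) hcE
  have hp0 : 0 ≤ ‖p‖ := norm_nonneg _
  have hB0 : 0 ≤ ‖B'‖ := norm_nonneg _
  -- `e^{ip}·V_k` is `(eR + 4‖p‖)`-regular on the guard plaquettes; its extension `12d(n+2)²(eR + 4‖p‖)`-regular inside `Z^{(k)}`
  have h1 : PlaqSmallOn (plaqsInside (pts k (Z ∩ Λᶜ))) (eR + 4 * ‖p‖) (expMul su2Chart p Vk) := plaqSmallOn_expMul_of_plaqSmallOn hVk p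
  have hpos : 0 < eR + 4 * ‖p‖ := by positivity
  have h2 : PlaqSmallOn (plaqsInside (pts k Z)) ((cE + 1) * (eR + 4 * ‖p‖)) (ext (expMul su2Chart p Vk)) :=
    plaqSmallOn_extend_of_guard hd3 Z Λ lo hi n hn hlohi hbox hZ hN3 ext hext hcE hpos _ h1
  -- `e^{iB′}` costs `4‖B′‖` more
  intro q hq
  have h3 := dist1_plaqHol_expMul_su2Chart_le B' (ext (expMul su2Chart p Vk)) q
  have h4 := h2 q hq
  calc dist1 (plaqHol (expMul su2Chart B' (ext (expMul su2Chart p Vk))) q)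
      ≤ dist1 (plaqHol (ext (expMul su2Chart p Vk)) q) + 4 * ‖B'‖ := h3
    _ < (cE + 1) * (eR + 4 * ‖p‖) + 4 * ‖B'‖ := by linarith
    _ ≤ (cE + 1) * (eR + 4 * ‖p‖ + 4 * ‖B'‖) := by nlinarith

end Perturbed

/-! ## §3  At the base point and on the (J0′) family's real points: minimality over the class AT THE DATUM SCALE; T4's `hMin` body in TWO-RADII form -/

section AtDatumScale

variable {Kt : ℕ}

/-- ★★★ **THE BASE POINT: the minimiser `U₀` of the (1.74) datum of an `eR`-regular base field MINIMISES OVER THE CLASS AT EVERY TOLERANCE `e ∈ [B₃(c_E+1)eR, εreg]` AND LIES IN THE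
CLASS AT `B₃(c_E+1)eR`** — what the direct road's class-reading producers ((σ)_W window gauge, plaquette letters, tower∕site proxies, chart-half `hmin0`) may be fed at
`ν″ := ν⟨εreg := e⟩` instead of `ν`, so that their tolerance floors read the DATA budget `eR` instead of the class constant `εreg` (lane ruling «(8)-FLOOR»).  Binders: the knit's
geometry rows of the instance (`Z, Λ, k, lo, hi, n, ext`, as in `B15Prop1Thm1RowsOfExistsUnique.thm1Rows_atZ_…` for one `i`), numerics `(c_E+1)eR ≤ a₁`, `B₃(c_E+1)eR ≤ e ≤ εreg ≤ a₀`,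
the closed (8)-letter `h15T`. [cite: Balaban1985Variational, (2),(6),(7) p.278, Thm 1 (8) p.279; Balaban1989LargeFieldI, (1.74) p.192, p.193 L14–20, Prop. 1 p.194; Balaban1988Convergent, (2.12)–(2.13) pp.256–257; Balaban1989LargeFieldII, p.357] -/
theorem isMinimizer_withEps_base_of_thm1TorusClass (ν : Node00.Stage7Numerics) (Kt : ℕ) (hd3 : 3 ≤ (F.P Kt).d)
    (Z Λ : Set (Site (F.P Kt) 0)) {k : ℕ} (hk0 : 0 < k) (hk : k ≤ (F.P Kt).m + (F.P Kt).K)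
    (lo hi : Fin (F.P Kt).d → ℤ) (n : ℕ) (hn : ∀ κ, hi κ ≤ lo κ + n) (hlohi : lo ≤ hi)
    (hbox : pts k Λ = (castSite '' Set.Icc lo hi : Set (Site (F.P Kt) k)))
    (hZ : (boxPlaqs (lo - 1) (hi + 1) : Set (Plaq (F.P Kt) k)) ⊆ plaqsInside (pts k Z))
    (hN3 : ∀ κ, hi κ - lo κ + 3 < ((F.P Kt).sitesPerDir k : ℤ))
    (ext : GaugeField (F.P Kt) k SU2 → GaugeField (F.P Kt) k SU2) (hext : ∀ W, ext W = extend (pts k Λ) (shellGauge W lo hi) W)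
    (hZblk : IsBlockUnion k Z) (hM2 : 2 ≤ ν.M₁) (hdiv : side (F.P Kt).L ν.M₁ k ∣ (F.P Kt).sitesPerDir 0)
    {cE B₃ a₀ a₁ : ℝ} (hcE : 12 * ((F.P Kt).d : ℝ) * ((n : ℝ) + 2) ^ 2 ≤ cE)
    (h15T : ∀ (k' : ℕ), k' ≤ (F.P Kt).m + (F.P Kt).K → side (F.P Kt).L ν.M₁ k' ∣ (F.P Kt).sitesPerDir 0 →
      ∀ (s : B14.Eq218Concrete.Seq (fun n : ℕ => Node00.unionsOfCubes (F.P Kt) (side (F.P Kt).L ν.M₁ n)) k'),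
      Node00.Sect2.SeqSeparated ν.M₁ s → 0 < ν.M₁ →
      ∀ (ε₀ : ℝ) (δ : ℕ → ℝ), (∀ j, j ≤ k' → 0 < δ j ∧ δ j ≤ a₁ ∧ B₃ * δ j ≤ ε₀) → (∀ j, j < k' → δ j ≤ 2 * δ (j + 1)) →
      (∀ j, j < k' → δ (j + 1) ≤ 2 * δ j) → ε₀ ≤ a₀ →
      ∀ W : MSField (F.P Kt) SU2,
        Node00.Sect2.DataSmall7PTop (Node00.avOfRecord F 2 Kt) s.Ω (Node00.suppDomOfRecord F ν Kt s.Ω) k' δ W →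
        ∀ U₀ : GaugeField (F.P Kt) 0 SU2, IsMinimizer (Node00.avOfRecord F 2 Kt)
            {U | (∀ j, j ≤ k' → PlaqSmallOn (Node00.Sect2.omegaPlaqsTop s.Ω (Node00.suppDomOfRecord F ν Kt s.Ω) j)
                (ε₀ * (F.P Kt).eta j ^ 2) U) ∧
              Node00.Sect2.CoDivClassOnTop s.Ω (Node00.suppDomOfRecord F ν Kt s.Ω) k' ε₀ U}
            (genSet s.Ω k') W U₀ →
          (∀ j, j ≤ k' → PlaqSmallOn (Node00.Sect2.omegaPlaqsTop s.Ω (Node00.suppDomOfRecord F ν Kt s.Ω) j)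
              (B₃ * δ j * (F.P Kt).eta j ^ 2) U₀) ∧
            ∀ j, j ≤ k' → Node00.Sect2.CoDivSmallOn (Node00.Sect2.omegaBondsTop s.Ω (Node00.suppDomOfRecord F ν Kt s.Ω) j)
              (B₃ * δ j * (F.P Kt).eta j ^ 3) U₀) :
    ∀ (e eR : ℝ) (Vk : GaugeField (F.P Kt) k SU2), 0 < eR → (cE + 1) * eR ≤ a₁ → B₃ * ((cE + 1) * eR) ≤ e → e ≤ ν.εreg → ν.εreg ≤ a₀ →
      PlaqSmallOn (plaqsInside (pts k (Z ∩ Λᶜ))) eR Vk →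
      ∀ U₀ : GaugeField (F.P Kt) 0 SU2,
        IsMinimizer (Node00.avOfRecord F 2 Kt) (Node00.regMSCoPOfRecord F 2 ν Kt k (maxDomT ν.M₁ Z)) (Bj ν.M₁ Z k)
          (avgFamily (Node00.avOfRecord F 2 Kt) (qsstarGIter0 k (ext Vk))) U₀ →
        U₀ ∈ Node00.regMSCoPOfRecord F 2 {ν with εreg := B₃ * ((cE + 1) * eR)} Kt k (maxDomT ν.M₁ Z) ∧
          IsMinimizer (Node00.avOfRecord F 2 Kt) (Node00.regMSCoPOfRecord F 2 {ν with εreg := e} Kt k (maxDomT ν.M₁ Z)) (Bj ν.M₁ Z k)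
            (avgFamily (Node00.avOfRecord F 2 Kt) (qsstarGIter0 k (ext Vk))) U₀ := by
  intro e eR Vk heR ha₁ he heν ha₀ hVk U₀ hU₀
  have hd : 2 ≤ (F.P Kt).d := by omega
  have hcE0 : 0 ≤ cE := le_trans (by positivity) hcE
  have hV : PlaqSmallOn (plaqsInside (pts k Z)) ((cE + 1) * eR) (ext Vk) :=
    plaqSmallOn_extend_of_guard hd3 Z Λ lo hi n hn hlohi hbox hZ hN3 ext hext hcE heR Vk hVk
  exact mem_withEps_and_isMinimizer_withEps_of_plaqSmallOn ν Kt hd Z hk0 hk hZblk hM2 hdiv h15T ((cE + 1) * eR) e (ext Vk) (by positivity)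
    ha₁ he heν ha₀ hV U₀ hU₀

/-- ★★★ **T4's `hMin` BODY IN TWO-RADII FORM, MINIMALITY READ AT THE DATUM SCALE** — the junction lemma of the lane ruling «(8)-FLOOR».  At one base field `V_k` of the strict guard
(`|V_k(∂p′) − 1| < eR` inside `(Z ∩ Λᶜ)^{(k)}`), the (J0′) letter of record (`Summits/…/BalabanUVNodesN12AtRecord13Prop1KnitThm1WindowDirectOfClassOnlyRowL1NearRadiusOfRecord` :164–:173,
one instance, VERBATIM: a family `Ũ` entrywise holomorphic on the parameter ball `ball 0 R`, bounded by `𝓐` there, whose REAL points `(p, B′)` are minimisers over the class OF RECORD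
`U_k({Ω_j(Z)}, εreg)` of the Wilson action with the perturbed (1.74) data `M˙(Q_k^{s*}(e^{iB′}·ext(e^{ip}·V_k)))`) IMPLIES the two-radii body: the SAME `Ũ`, clauses 1–2 on `ball 0 R`
unchanged (what the (K) row's Cauchy estimate reads), and clause 3 on the SMALLER real ball `‖p‖, ‖B′‖ < min R (eR∕8)` with minimality over the class at ANY tolerance
`e ∈ [2B₃(c_E+1)eR, εreg]` (what the chart half's `∀ᶠ` second-order condition reads) — by §2 the perturbed datum is `(c_E+1)(eR + 4‖p‖ + 4‖B′‖) < 2(c_E+1)eR`-regular there, so §1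
applies.  Numerics: `2(c_E+1)eR ≤ a₁`, `2B₃(c_E+1)eR ≤ e ≤ εreg ≤ a₀`. [cite: Balaban1985Variational, (2),(6),(7) p.278, Thm 1 (8) p.279; Balaban1989LargeFieldI, (1.74) p.192, p.193 L14–20, Prop. 1 (1.77)–(1.78) p.194; Balaban1989LargeFieldII, p.357, (1.7)–(1.9) p.358; Balaban1988Convergent, (2.12)–(2.13) pp.256–257] -/
theorem hMin_twoRadii_withEps_of_hMin (ν : Node00.Stage7Numerics) (Kt : ℕ) (hd3 : 3 ≤ (F.P Kt).d)
    (Z Λ : Set (Site (F.P Kt) 0)) {k : ℕ} (hk0 : 0 < k) (hk : k ≤ (F.P Kt).m + (F.P Kt).K)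
    (lo hi : Fin (F.P Kt).d → ℤ) (n : ℕ) (hn : ∀ κ, hi κ ≤ lo κ + n) (hlohi : lo ≤ hi)
    (hbox : pts k Λ = (castSite '' Set.Icc lo hi : Set (Site (F.P Kt) k)))
    (hZ : (boxPlaqs (lo - 1) (hi + 1) : Set (Plaq (F.P Kt) k)) ⊆ plaqsInside (pts k Z))
    (hN3 : ∀ κ, hi κ - lo κ + 3 < ((F.P Kt).sitesPerDir k : ℤ))
    (ext : GaugeField (F.P Kt) k SU2 → GaugeField (F.P Kt) k SU2) (hext : ∀ W, ext W = extend (pts k Λ) (shellGauge W lo hi) W)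
    (hZblk : IsBlockUnion k Z) (hM2 : 2 ≤ ν.M₁) (hdiv : side (F.P Kt).L ν.M₁ k ∣ (F.P Kt).sitesPerDir 0)
    {cE B₃ a₀ a₁ : ℝ} (hcE : 12 * ((F.P Kt).d : ℝ) * ((n : ℝ) + 2) ^ 2 ≤ cE)
    (h15T : ∀ (k' : ℕ), k' ≤ (F.P Kt).m + (F.P Kt).K → side (F.P Kt).L ν.M₁ k' ∣ (F.P Kt).sitesPerDir 0 →
      ∀ (s : B14.Eq218Concrete.Seq (fun n : ℕ => Node00.unionsOfCubes (F.P Kt) (side (F.P Kt).L ν.M₁ n)) k'),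
      Node00.Sect2.SeqSeparated ν.M₁ s → 0 < ν.M₁ →
      ∀ (ε₀ : ℝ) (δ : ℕ → ℝ), (∀ j, j ≤ k' → 0 < δ j ∧ δ j ≤ a₁ ∧ B₃ * δ j ≤ ε₀) → (∀ j, j < k' → δ j ≤ 2 * δ (j + 1)) →
      (∀ j, j < k' → δ (j + 1) ≤ 2 * δ j) → ε₀ ≤ a₀ →
      ∀ W : MSField (F.P Kt) SU2,
        Node00.Sect2.DataSmall7PTop (Node00.avOfRecord F 2 Kt) s.Ω (Node00.suppDomOfRecord F ν Kt s.Ω) k' δ W →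
        ∀ U₀ : GaugeField (F.P Kt) 0 SU2, IsMinimizer (Node00.avOfRecord F 2 Kt)
            {U | (∀ j, j ≤ k' → PlaqSmallOn (Node00.Sect2.omegaPlaqsTop s.Ω (Node00.suppDomOfRecord F ν Kt s.Ω) j)
                (ε₀ * (F.P Kt).eta j ^ 2) U) ∧
              Node00.Sect2.CoDivClassOnTop s.Ω (Node00.suppDomOfRecord F ν Kt s.Ω) k' ε₀ U}
            (genSet s.Ω k') W U₀ →
          (∀ j, j ≤ k' → PlaqSmallOn (Node00.Sect2.omegaPlaqsTop s.Ω (Node00.suppDomOfRecord F ν Kt s.Ω) j)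
              (B₃ * δ j * (F.P Kt).eta j ^ 2) U₀) ∧
            ∀ j, j ≤ k' → Node00.Sect2.CoDivSmallOn (Node00.Sect2.omegaBondsTop s.Ω (Node00.suppDomOfRecord F ν Kt s.Ω) j)
              (B₃ * δ j * (F.P Kt).eta j ^ 3) U₀)
    {e eR : ℝ} (heR : 0 < eR) (ha₁ : 2 * ((cE + 1) * eR) ≤ a₁) (he : B₃ * (2 * ((cE + 1) * eR)) ≤ e) (heν : e ≤ ν.εreg) (ha₀ : ν.εreg ≤ a₀)
    (Vk : GaugeField (F.P Kt) k SU2) (hVk : PlaqSmallOn (plaqsInside (pts k (Z ∩ Λᶜ))) eR Vk) {R 𝓐 : ℝ}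
    -- T4's `hMin` body at `(Z, Λ, k, ext, V_k)`: ONE radius, class OF RECORD
    (hMin : ∃ Ũ : VecField (F.P Kt) k (EuclideanSpace ℂ (Fin 3)) × VecField (F.P Kt) k (EuclideanSpace ℂ (Fin 3)) → PBond (F.P Kt) 0 → Matrix (Fin 2) (Fin 2) ℂ,
      (∀ b i j, DifferentiableOn ℂ (fun z => Ũ z b i j) (ball 0 R)) ∧
      (∀ z ∈ ball (0 : VecField (F.P Kt) k (EuclideanSpace ℂ (Fin 3)) × VecField (F.P Kt) k (EuclideanSpace ℂ (Fin 3))) R, ∀ b i j, ‖Ũ z b i j‖ ≤ 𝓐) ∧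
      ∀ p B' : VecField (F.P Kt) k E3, ‖p‖ < R → ‖B'‖ < R → ∃ U' : GaugeField (F.P Kt) 0 SU2,
        (∀ b, Ũ (cplxVec p, cplxVec B') b = ((U' b : SU2) : Matrix (Fin 2) (Fin 2) ℂ)) ∧
          IsMinimizer (Node00.avOfRecord F 2 Kt) (Node00.regMSCoPOfRecord F 2 ν Kt k (maxDomT ν.M₁ Z)) (Bj ν.M₁ Z k)
            (avgFamily (Node00.avOfRecord F 2 Kt) (qsstarGIter0 k (expMul su2Chart B' (ext (expMul su2Chart p Vk))))) U') :
    ∃ Ũ : VecField (F.P Kt) k (EuclideanSpace ℂ (Fin 3)) × VecField (F.P Kt) k (EuclideanSpace ℂ (Fin 3)) → PBond (F.P Kt) 0 → Matrix (Fin 2) (Fin 2) ℂ,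
      (∀ b i j, DifferentiableOn ℂ (fun z => Ũ z b i j) (ball 0 R)) ∧
      (∀ z ∈ ball (0 : VecField (F.P Kt) k (EuclideanSpace ℂ (Fin 3)) × VecField (F.P Kt) k (EuclideanSpace ℂ (Fin 3))) R, ∀ b i j, ‖Ũ z b i j‖ ≤ 𝓐) ∧
      ∀ p B' : VecField (F.P Kt) k E3, ‖p‖ < min R (eR / 8) → ‖B'‖ < min R (eR / 8) → ∃ U' : GaugeField (F.P Kt) 0 SU2,
        (∀ b, Ũ (cplxVec p, cplxVec B') b = ((U' b : SU2) : Matrix (Fin 2) (Fin 2) ℂ)) ∧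
          U' ∈ Node00.regMSCoPOfRecord F 2 {ν with εreg := B₃ * (2 * ((cE + 1) * eR))} Kt k (maxDomT ν.M₁ Z) ∧
          IsMinimizer (Node00.avOfRecord F 2 Kt) (Node00.regMSCoPOfRecord F 2 {ν with εreg := e} Kt k (maxDomT ν.M₁ Z)) (Bj ν.M₁ Z k)
            (avgFamily (Node00.avOfRecord F 2 Kt) (qsstarGIter0 k (expMul su2Chart B' (ext (expMul su2Chart p Vk))))) U' := by
  obtain ⟨Ũ, han, hbd, hreal⟩ := hMin
  have hd : 2 ≤ (F.P Kt).d := by omega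
  have hcE0 : 0 ≤ cE := le_trans (by positivity) hcE
  refine ⟨Ũ, han, hbd, fun p B' hp hB' => ?_⟩
  obtain ⟨U', hU', hmin⟩ := hreal p B' (lt_of_lt_of_le hp (min_le_left _ _)) (lt_of_lt_of_le hB' (min_le_left _ _))
  -- the perturbed datum's level-`k` field is `2(c_E+1)eR`-regular inside `Z^{(k)}`
  have hp8 : ‖p‖ < eR / 8 := lt_of_lt_of_le hp (min_le_right _ _)
  have hB8 : ‖B'‖ < eR / 8 := lt_of_lt_of_le hB' (min_le_right _ _)
  have hreg := plaqSmallOn_expMul_extend_expMul hd3 Z Λ lo hi n hn hlohi hbox hZ hN3 ext hext hcE heR Vk hVk p B'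
  have hreg2 : PlaqSmallOn (plaqsInside (pts k Z)) (2 * ((cE + 1) * eR)) (expMul su2Chart B' (ext (expMul su2Chart p Vk))) := by
    intro q hq
    refine (hreg q hq).trans_le ?_
    have h1 : eR + 4 * ‖p‖ + 4 * ‖B'‖ ≤ 2 * eR := by linarith
    nlinarith
  obtain ⟨hmem, hmin'⟩ := mem_withEps_and_isMinimizer_withEps_of_plaqSmallOn ν Kt hd Z hk0 hk hZblk hM2 hdiv h15T (2 * ((cE + 1) * eR)) e
    (expMul su2Chart B' (ext (expMul su2Chart p Vk))) (by positivity) ha₁ he heν ha₀ hreg2 U' hmin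
  exact ⟨U', hU', hmem, hmin'⟩

end AtDatumScale

/-! ## §4  The chart half's `∀ᶠ` row: the Federbush family's configurations minimise over the class AT THE DATUM SCALE, eventually -/

section Eventually

open Filter Topology
open B15Prop1SliceCoordinates (GaugeSlice ιA)
open B15Prop1SliceTaylorCalculus (norm_ιA_le)

variable {Kt : ℕ}

/-- ★★★ **EVERY CLASS-OF-RECORD MINIMISER OF A SLICE-PERTURBED DATUM `e^{i·ιA Y}·ext V_k`, `‖Y‖ < eR∕8`, LIES IN THE CLASS AT `2B₃(c_E+1)eR` AND MINIMISES OVER THE CLASS AT EVERY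
`e ∈ [2B₃(c_E+1)eR, εreg]`** — the radius form of dag-n12-d's conversion letter (K-b) (T1′'s `hKb`, radius `r := eR∕8`): for a base field `V_k` of the strict guard at `eR`, a coordinate
`Y ∈ GaugeSlice(Λ^{(k)}, T)` with `‖Y‖ < eR∕8`, and ANY configuration `U` minimising the Wilson action over `U_k({Ω_j(Z)}, εreg)` with the data `M˙(Q_k^{s*}(e^{i·ιA Y}·ext V_k))`: the
perturbed datum's level-`k` field is `(c_E+1)eR + 4‖ιA Y‖ < 2(c_E+1)eR`-regular inside `Z^{(k)}` (§2, `‖ιA Y‖ ≤ ‖Y‖`), so §1 applies.  Only the (8)-letter `h15T` is used.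
[cite: Balaban1985Variational, (2),(6),(7) p.278, Thm 1 (8) p.279; Balaban1989LargeFieldI, (1.74) p.192, p.193 L14–20, Prop. 1 p.194; Balaban1989LargeFieldII, p.357, (1.7)–(1.9) p.358, (1.12) p.359; Balaban1988Convergent, (2.12)–(2.13) pp.256–257] -/
theorem isMinimizer_withEps_of_norm_lt (ν : Node00.Stage7Numerics) (Kt : ℕ) (hd3 : 3 ≤ (F.P Kt).d)
    (Z Λ : Set (Site (F.P Kt) 0)) {k : ℕ} (hk0 : 0 < k) (hk : k ≤ (F.P Kt).m + (F.P Kt).K)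
    (lo hi : Fin (F.P Kt).d → ℤ) (n : ℕ) (hn : ∀ κ, hi κ ≤ lo κ + n) (hlohi : lo ≤ hi)
    (hbox : pts k Λ = (castSite '' Set.Icc lo hi : Set (Site (F.P Kt) k)))
    (hZ : (boxPlaqs (lo - 1) (hi + 1) : Set (Plaq (F.P Kt) k)) ⊆ plaqsInside (pts k Z))
    (hN3 : ∀ κ, hi κ - lo κ + 3 < ((F.P Kt).sitesPerDir k : ℤ))
    (ext : GaugeField (F.P Kt) k SU2 → GaugeField (F.P Kt) k SU2) (hext : ∀ W, ext W = extend (pts k Λ) (shellGauge W lo hi) W)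
    (hZblk : IsBlockUnion k Z) (hM2 : 2 ≤ ν.M₁) (hdiv : side (F.P Kt).L ν.M₁ k ∣ (F.P Kt).sitesPerDir 0)
    {cE B₃ a₀ a₁ : ℝ} (hcE : 12 * ((F.P Kt).d : ℝ) * ((n : ℝ) + 2) ^ 2 ≤ cE)
    (h15T : ∀ (k' : ℕ), k' ≤ (F.P Kt).m + (F.P Kt).K → side (F.P Kt).L ν.M₁ k' ∣ (F.P Kt).sitesPerDir 0 →
      ∀ (s : B14.Eq218Concrete.Seq (fun n : ℕ => Node00.unionsOfCubes (F.P Kt) (side (F.P Kt).L ν.M₁ n)) k'),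
      Node00.Sect2.SeqSeparated ν.M₁ s → 0 < ν.M₁ →
      ∀ (ε₀ : ℝ) (δ : ℕ → ℝ), (∀ j, j ≤ k' → 0 < δ j ∧ δ j ≤ a₁ ∧ B₃ * δ j ≤ ε₀) → (∀ j, j < k' → δ j ≤ 2 * δ (j + 1)) →
      (∀ j, j < k' → δ (j + 1) ≤ 2 * δ j) → ε₀ ≤ a₀ →
      ∀ W : MSField (F.P Kt) SU2,
        Node00.Sect2.DataSmall7PTop (Node00.avOfRecord F 2 Kt) s.Ω (Node00.suppDomOfRecord F ν Kt s.Ω) k' δ W →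
        ∀ U₀ : GaugeField (F.P Kt) 0 SU2, IsMinimizer (Node00.avOfRecord F 2 Kt)
            {U | (∀ j, j ≤ k' → PlaqSmallOn (Node00.Sect2.omegaPlaqsTop s.Ω (Node00.suppDomOfRecord F ν Kt s.Ω) j)
                (ε₀ * (F.P Kt).eta j ^ 2) U) ∧
              Node00.Sect2.CoDivClassOnTop s.Ω (Node00.suppDomOfRecord F ν Kt s.Ω) k' ε₀ U}
            (genSet s.Ω k') W U₀ →
          (∀ j, j ≤ k' → PlaqSmallOn (Node00.Sect2.omegaPlaqsTop s.Ω (Node00.suppDomOfRecord F ν Kt s.Ω) j)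
              (B₃ * δ j * (F.P Kt).eta j ^ 2) U₀) ∧
            ∀ j, j ≤ k' → Node00.Sect2.CoDivSmallOn (Node00.Sect2.omegaBondsTop s.Ω (Node00.suppDomOfRecord F ν Kt s.Ω) j)
              (B₃ * δ j * (F.P Kt).eta j ^ 3) U₀)
    {e eR : ℝ} (heR : 0 < eR) (ha₁ : 2 * ((cE + 1) * eR) ≤ a₁) (he : B₃ * (2 * ((cE + 1) * eR)) ≤ e) (heν : e ≤ ν.εreg) (ha₀ : ν.εreg ≤ a₀)
    (Vk : GaugeField (F.P Kt) k SU2) (hVk : PlaqSmallOn (plaqsInside (pts k (Z ∩ Λᶜ))) eR Vk)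
    (T : Finset (PBond (F.P Kt) k)) :
    ∀ (Y : GaugeSlice (pts k Λ) T E3), ‖Y‖ < eR / 8 → ∀ U : GaugeField (F.P Kt) 0 SU2,
      IsMinimizer (Node00.avOfRecord F 2 Kt) (Node00.regMSCoPOfRecord F 2 ν Kt k (maxDomT ν.M₁ Z)) (Bj ν.M₁ Z k)
        (avgFamily (Node00.avOfRecord F 2 Kt) (qsstarGIter0 k (expMul su2Chart (ιA (pts k Λ) T Y) (ext Vk)))) U →
      U ∈ Node00.regMSCoPOfRecord F 2 {ν with εreg := B₃ * (2 * ((cE + 1) * eR))} Kt k (maxDomT ν.M₁ Z) ∧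
        IsMinimizer (Node00.avOfRecord F 2 Kt) (Node00.regMSCoPOfRecord F 2 {ν with εreg := e} Kt k (maxDomT ν.M₁ Z)) (Bj ν.M₁ Z k)
          (avgFamily (Node00.avOfRecord F 2 Kt) (qsstarGIter0 k (expMul su2Chart (ιA (pts k Λ) T Y) (ext Vk)))) U := by
  intro Y hY U hmin
  have hd : 2 ≤ (F.P Kt).d := by omega
  have hcE0 : 0 ≤ cE := le_trans (by positivity) hcE
  -- the base datum's extension is `(c_E+1)eR`-regular; the perturbation costs `4‖ιA Y‖ ≤ 4‖Y‖`
  have hext0 : PlaqSmallOn (plaqsInside (pts k Z)) ((cE + 1) * eR) (ext Vk) :=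
    plaqSmallOn_extend_of_guard hd3 Z Λ lo hi n hn hlohi hbox hZ hN3 ext hext hcE heR Vk hVk
  have hι : ‖ιA (pts k Λ) T Y‖ ≤ ‖Y‖ := norm_ιA_le (pts k Λ) T Y
  have h1 : PlaqSmallOn (plaqsInside (pts k Z)) ((cE + 1) * eR + 4 * ‖ιA (pts k Λ) T Y‖) (expMul su2Chart (ιA (pts k Λ) T Y) (ext Vk)) :=
    plaqSmallOn_expMul_of_plaqSmallOn hext0 _
  have h2 : PlaqSmallOn (plaqsInside (pts k Z)) (2 * ((cE + 1) * eR)) (expMul su2Chart (ιA (pts k Λ) T Y) (ext Vk)) := by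
    intro q hq
    refine (h1 q hq).trans_le ?_
    nlinarith
  exact mem_withEps_and_isMinimizer_withEps_of_plaqSmallOn ν Kt hd Z hk0 hk hZblk hM2 hdiv h15T (2 * ((cE + 1) * eR)) e
    (expMul su2Chart (ιA (pts k Λ) T Y) (ext Vk)) (by positivity) ha₁ he heν ha₀ h2 U hmin

/-- ★★★ **THE CHART HALF's `∀ᶠ` ROW AT THE DATUM SCALE** — dag-n12-d's callback (K-b), `∀ᶠ` form.  For a base field `V_k` of the strict guard at `eR` and ANY family of configurations
`Φ : GaugeSlice(Λ^{(k)}, T) → configurations` which, for `Y` near `0`, minimise the Wilson action over the class OF RECORD `U_k({Ω_j(Z)}, εreg)` with the perturbed (1.74) data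
`M˙(Q_k^{s*}(e^{i·ιA Y}·ext V_k))` (T4's `hhalf` premise :233–:235, the Federbush family `Y ↦ expChart U₀ (X_f Y)`): for `Y` near `0` the configuration `Φ Y` LIES IN the class at
`2B₃(c_E+1)eR` and MINIMISES over the class at every `e ∈ [2B₃(c_E+1)eR, εreg]` (the radius form on `‖Y‖ < eR∕8`).  Only the (8)-letter `h15T` is used (no existence ∕ uniqueness
letter). [cite: Balaban1985Variational, (2),(6),(7) p.278, Thm 1 (8) p.279; Balaban1989LargeFieldI, (1.74) p.192, p.193 L14–20, Prop. 1 p.194; Balaban1989LargeFieldII, p.357, (1.7)–(1.9) p.358, (1.12) p.359; Balaban1988Convergent, (2.12)–(2.13) pp.256–257] -/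
theorem eventually_isMinimizer_withEps_of_eventually (ν : Node00.Stage7Numerics) (Kt : ℕ) (hd3 : 3 ≤ (F.P Kt).d)
    (Z Λ : Set (Site (F.P Kt) 0)) {k : ℕ} (hk0 : 0 < k) (hk : k ≤ (F.P Kt).m + (F.P Kt).K)
    (lo hi : Fin (F.P Kt).d → ℤ) (n : ℕ) (hn : ∀ κ, hi κ ≤ lo κ + n) (hlohi : lo ≤ hi)
    (hbox : pts k Λ = (castSite '' Set.Icc lo hi : Set (Site (F.P Kt) k)))
    (hZ : (boxPlaqs (lo - 1) (hi + 1) : Set (Plaq (F.P Kt) k)) ⊆ plaqsInside (pts k Z))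
    (hN3 : ∀ κ, hi κ - lo κ + 3 < ((F.P Kt).sitesPerDir k : ℤ))
    (ext : GaugeField (F.P Kt) k SU2 → GaugeField (F.P Kt) k SU2) (hext : ∀ W, ext W = extend (pts k Λ) (shellGauge W lo hi) W)
    (hZblk : IsBlockUnion k Z) (hM2 : 2 ≤ ν.M₁) (hdiv : side (F.P Kt).L ν.M₁ k ∣ (F.P Kt).sitesPerDir 0)
    {cE B₃ a₀ a₁ : ℝ} (hcE : 12 * ((F.P Kt).d : ℝ) * ((n : ℝ) + 2) ^ 2 ≤ cE)
    (h15T : ∀ (k' : ℕ), k' ≤ (F.P Kt).m + (F.P Kt).K → side (F.P Kt).L ν.M₁ k' ∣ (F.P Kt).sitesPerDir 0 →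
      ∀ (s : B14.Eq218Concrete.Seq (fun n : ℕ => Node00.unionsOfCubes (F.P Kt) (side (F.P Kt).L ν.M₁ n)) k'),
      Node00.Sect2.SeqSeparated ν.M₁ s → 0 < ν.M₁ →
      ∀ (ε₀ : ℝ) (δ : ℕ → ℝ), (∀ j, j ≤ k' → 0 < δ j ∧ δ j ≤ a₁ ∧ B₃ * δ j ≤ ε₀) → (∀ j, j < k' → δ j ≤ 2 * δ (j + 1)) →
      (∀ j, j < k' → δ (j + 1) ≤ 2 * δ j) → ε₀ ≤ a₀ →
      ∀ W : MSField (F.P Kt) SU2,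
        Node00.Sect2.DataSmall7PTop (Node00.avOfRecord F 2 Kt) s.Ω (Node00.suppDomOfRecord F ν Kt s.Ω) k' δ W →
        ∀ U₀ : GaugeField (F.P Kt) 0 SU2, IsMinimizer (Node00.avOfRecord F 2 Kt)
            {U | (∀ j, j ≤ k' → PlaqSmallOn (Node00.Sect2.omegaPlaqsTop s.Ω (Node00.suppDomOfRecord F ν Kt s.Ω) j)
                (ε₀ * (F.P Kt).eta j ^ 2) U) ∧
              Node00.Sect2.CoDivClassOnTop s.Ω (Node00.suppDomOfRecord F ν Kt s.Ω) k' ε₀ U}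
            (genSet s.Ω k') W U₀ →
          (∀ j, j ≤ k' → PlaqSmallOn (Node00.Sect2.omegaPlaqsTop s.Ω (Node00.suppDomOfRecord F ν Kt s.Ω) j)
              (B₃ * δ j * (F.P Kt).eta j ^ 2) U₀) ∧
            ∀ j, j ≤ k' → Node00.Sect2.CoDivSmallOn (Node00.Sect2.omegaBondsTop s.Ω (Node00.suppDomOfRecord F ν Kt s.Ω) j)
              (B₃ * δ j * (F.P Kt).eta j ^ 3) U₀)
    {e eR : ℝ} (heR : 0 < eR) (ha₁ : 2 * ((cE + 1) * eR) ≤ a₁) (he : B₃ * (2 * ((cE + 1) * eR)) ≤ e) (heν : e ≤ ν.εreg) (ha₀ : ν.εreg ≤ a₀)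
    (Vk : GaugeField (F.P Kt) k SU2) (hVk : PlaqSmallOn (plaqsInside (pts k (Z ∩ Λᶜ))) eR Vk)
    (T : Finset (PBond (F.P Kt) k)) (Φ : GaugeSlice (pts k Λ) T E3 → GaugeField (F.P Kt) 0 SU2)
    -- T4's `hhalf` premise: the family's configurations are class-OF-RECORD minimisers of the perturbed data, for `Y` near `0`
    (hfam : ∀ᶠ Y in 𝓝 (0 : GaugeSlice (pts k Λ) T E3),
      IsMinimizer (Node00.avOfRecord F 2 Kt) (Node00.regMSCoPOfRecord F 2 ν Kt k (maxDomT ν.M₁ Z)) (Bj ν.M₁ Z k)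
        (avgFamily (Node00.avOfRecord F 2 Kt) (qsstarGIter0 k (expMul su2Chart (ιA (pts k Λ) T Y) (ext Vk)))) (Φ Y)) :
    ∀ᶠ Y in 𝓝 (0 : GaugeSlice (pts k Λ) T E3),
      Φ Y ∈ Node00.regMSCoPOfRecord F 2 {ν with εreg := B₃ * (2 * ((cE + 1) * eR))} Kt k (maxDomT ν.M₁ Z) ∧
        IsMinimizer (Node00.avOfRecord F 2 Kt) (Node00.regMSCoPOfRecord F 2 {ν with εreg := e} Kt k (maxDomT ν.M₁ Z)) (Bj ν.M₁ Z k)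
          (avgFamily (Node00.avOfRecord F 2 Kt) (qsstarGIter0 k (expMul su2Chart (ιA (pts k Λ) T Y) (ext Vk)))) (Φ Y) := by
  -- `Y` near `0` has `‖Y‖ < eR∕8`
  have hsmall : ∀ᶠ Y in 𝓝 (0 : GaugeSlice (pts k Λ) T E3), ‖Y‖ < eR / 8 :=
    Filter.mem_of_superset (Metric.ball_mem_nhds (0 : GaugeSlice (pts k Λ) T E3) (by positivity : 0 < eR / 8))
      fun Y hY => by simpa [Metric.mem_ball, dist_zero_right] using hY
  filter_upwards [hfam, hsmall] with Y hmin hY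
  exact isMinimizer_withEps_of_norm_lt ν Kt hd3 Z Λ hk0 hk lo hi n hn hlohi hbox hZ hN3 ext hext hZblk hM2 hdiv hcE h15T heR ha₁ he heν ha₀ Vk hVk T Y hY (Φ Y) hmin

end Eventually

end Literature.MathematicalPhysics.QuantumFieldTheory.Balaban1983to89.B15Prop1MinimiserClassAtDatumScale

end
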